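import Mathlib
import Summits.ValiantsHypothesis.ValiantsHypothesis.Theorems.LiouvilleSarnakLiouvilleCutRankStrayRowsBottom
import Summits.ValiantsHypothesis.ValiantsHypothesis.Theorems.LiouvilleSarnakLiouvilleCutRankOneScaleWindowEmbedding
import Summits.ValiantsHypothesis.ValiantsHypothesis.Theorems.LiouvilleSarnakDigitalBilinearLiouvilleRectanglesLowCols

/-!
# Route LiouvilleSarnak — crux `LiouvilleCutRank` (stmt-ValiantsHypothesis-14775):
# stray windows with the pure block at the BOTTOM — every level

Companion of `Theorems/LiouvilleSarnakLiouvilleCutRankStrayWindows.lean` (pure block of `n₁ - k` equal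
letters at the TOP of a balanced window) for the BOTTOM case, from
`StrayRows.le_rank_of_bottomRows` (`Theorems/LiouvilleSarnakLiouvilleCutRankStrayRowsBottom.lean`):

* `le_rank_of_bottomCols` — bottom `n₁ - k` positions all COLUMN bits (transpose).
* ★ `le_rank_of_strayWindowBottom` — at EVERY level `n`: a balanced window `s, …, s + 2n₁ - 1` of a cut
  `π` (`n₁ ≥ n₀(W, k)`) whose BOTTOM `n₁ - k` positions are all row bits, or all column bits, forces
  `rank M_π ≥ W` (window embedding `OneScale.rank_inducedCut_le`).

With the top version: every cut containing a balanced `2n₁`-window (`n₁ ≥ n₀(W,k)`) with a pure block of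
`n₁ - k` letters at either end has rank `≥ W` — the solved class of the crux, unconditionally.

Honest framing: unconditional enlargement of the solved class of the OPEN crux `LiouvilleCutRank`;
general cuts, `DigitalBilinearLiouville` and `AlgebraicSarnak` stay OPEN, and nothing here bears on VP
versus VNP.  No definitions. [cite: Coons2011, Theorem 1.5]
-/

-- the directory `ValiantsHypothesis/ValiantsHypothesis` repeats the summit name (tree layout)
set_option linter.dupNamespace false

namespace Summit.ValiantsHypothesis.ValiantsHypothesis.Theorems.LiouvilleSarnakLiouvilleCutRank.StrayRows

open ArithmeticFunction

open Summit.ValiantsHypothesis.ValiantsHypothesis.Theorems.LiouvilleSarnakLiouvilleCutRank.OneScale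
  (exists_inducedCut rank_inducedCut_le)
open Summit.ValiantsHypothesis.ValiantsHypothesis.Theorems.LiouvilleSarnakDigitalBilinearLiouville.Rectangles
  (cutNumber_swap)

/-- **Column bits at the bottom.**  For all `W, k` there is `n₀` such that every balanced cut `π₁` at
level `n₁ ≥ n₀` whose positions `< n₁ - k` are all COLUMN bits has rank `≥ W` (transpose of
`le_rank_of_bottomRows`). [cite: Coons2011, Theorem 1.5] -/
theorem le_rank_of_bottomCols (W k : ℕ) : ∃ n₀ : ℕ, ∀ n₁ : ℕ, n₀ ≤ n₁ →
    ∀ π₁ : Fin n₁ ⊕ Fin n₁ ≃ Fin (2 * n₁),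
      (∀ j : Fin (2 * n₁), (j : ℕ) < n₁ - k → (π₁.symm j).isRight = true) →
      W ≤ (Matrix.of fun r c : Fin n₁ → Bool =>
        (((liouville (Nat.ofBits (fun j : Fin (2 * n₁) => Sum.elim r c (π₁.symm j)) + 1) : ℤ) :
          ℂ))).rank := by
  obtain ⟨n₀, hn₀⟩ := le_rank_of_bottomRows W k
  refine ⟨n₀, fun n₁ hn₁ π₁ htop => ?_⟩
  set π' : Fin n₁ ⊕ Fin n₁ ≃ Fin (2 * n₁) := (Equiv.sumComm (Fin n₁) (Fin n₁)).trans π₁ with hπ'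
  have htop' : ∀ j : Fin (2 * n₁), (j : ℕ) < n₁ - k → (π'.symm j).isLeft = true := by
    intro j hj
    rw [hπ', Equiv.symm_trans_apply, Equiv.sumComm_symm, Equiv.sumComm_apply, Sum.isLeft_swap]
    exact htop j hj
  have key := hn₀ n₁ hn₁ π' htop'
  have hT : (Matrix.of fun r c : Fin n₁ → Bool =>
      (((liouville (Nat.ofBits (fun j : Fin (2 * n₁) => Sum.elim r c (π'.symm j)) + 1) : ℤ) :
        ℂ))) =
      (Matrix.of fun r c : Fin n₁ → Bool =>
        (((liouville (Nat.ofBits (fun j : Fin (2 * n₁) => Sum.elim r c (π₁.symm j)) + 1) : ℤ) :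
          ℂ))).transpose := by
    ext c r
    rw [Matrix.transpose_apply, Matrix.of_apply, Matrix.of_apply, hπ', cutNumber_swap]
  rw [hT, Matrix.rank_transpose] at key
  exact key

/-- ★ **Stray windows with the pure block at the bottom, at every level.**  For all `W, k` there is
`n₀` such that for every `n₁ ≥ n₀`, every level `n`, every cut `π` of the `2n` positions and every
window `s, …, s + 2n₁ - 1 < 2n` containing exactly `n₁` row bits whose bottom `n₁ - k` positions are
all row bits — or all column bits — one has `rank M_π ≥ W`. [cite: Coons2011, Theorem 1.5] -/
theorem le_rank_of_strayWindowBottom (W k : ℕ) : ∃ n₀ : ℕ, ∀ n₁ : ℕ, n₀ ≤ n₁ →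
    ∀ (n : ℕ) (π : Fin n ⊕ Fin n ≃ Fin (2 * n)) (s : ℕ), s + 2 * n₁ ≤ 2 * n →
      Nat.count (fun k' => (if h : s + k' < 2 * n then (π.symm ⟨s + k', h⟩).isLeft else false) = true)
        (2 * n₁) = n₁ →
      ((∀ j : Fin (2 * n), s ≤ (j : ℕ) → (j : ℕ) < s + (n₁ - k) → (π.symm j).isLeft = true) ∨
       (∀ j : Fin (2 * n), s ≤ (j : ℕ) → (j : ℕ) < s + (n₁ - k) → (π.symm j).isRight = true)) →
      W ≤ (Matrix.of fun r c : Fin n → Bool =>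
        (((liouville (Nat.ofBits (fun j : Fin (2 * n) => Sum.elim r c (π.symm j)) + 1) : ℤ) :
          ℂ))).rank := by
  obtain ⟨n₀, hn₀⟩ := le_rank_of_bottomRows W k
  obtain ⟨n₀', hn₀'⟩ := le_rank_of_bottomCols W k
  refine ⟨max n₀ n₀', fun n₁ hn₁ n π s hs hcount htop => ?_⟩
  set w : ℕ → Bool := fun k' => if h : k' < 2 * n then (π.symm ⟨k', h⟩).isLeft else false with hw
  have hw' : ∀ j : Fin (2 * n), s ≤ (j : ℕ) → (j : ℕ) < s + 2 * n₁ → w j = (π.symm j).isLeft :=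
    fun j _ _ => by simp [hw, j.isLt]
  have hcount' : Nat.count (fun k' => w (s + k') = true) (2 * n₁) = n₁ := by
    simpa [hw] using hcount
  obtain ⟨π₁, hπ₁⟩ := exists_inducedCut n₁ s w hcount'
  have hemb := rank_inducedCut_le n₁ n π w s hs hw' π₁ hπ₁
  refine le_trans ?_ hemb
  -- the induced cut has its bottom `n₁ - k` positions all rows, resp. all columns
  have hwin : ∀ k' : Fin (2 * n₁), (π₁.symm k').isLeft = (π.symm ⟨s + k', by omega⟩).isLeft := by
    intro k'
    rw [hπ₁ k', hw]
    simp only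
    rw [dif_pos (by omega)]
  rcases htop with htop | htop
  · refine hn₀ n₁ (le_of_max_le_left hn₁) π₁ fun j hj => ?_
    rw [hwin j]
    exact htop ⟨s + j, by omega⟩ (by show s ≤ s + (j : ℕ); omega)
      (by show s + (j : ℕ) < s + (n₁ - k); omega)
  · refine hn₀' n₁ (le_of_max_le_right hn₁) π₁ fun j hj => ?_
    have h1 := htop ⟨s + j, by omega⟩ (by show s ≤ s + (j : ℕ); omega)
      (by show s + (j : ℕ) < s + (n₁ - k); omega)
    have h2 := hwin j
    -- isRight = !isLeft
    rw [← Sum.not_isLeft, h2, Sum.not_isLeft]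
    exact h1

end Summit.ValiantsHypothesis.ValiantsHypothesis.Theorems.LiouvilleSarnakLiouvilleCutRank.StrayRows
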